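import Summits.QuantumFields.YangMills.Theorems.BalabanUVNodesN22AtRateRecord13Fixed
import Summits.QuantumFields.YangMills.Theorems.BalabanUVNodesRateCarriersOfRecord13CoPH
import Summits.QuantumFields.YangMills.Theorems.BalabanUVNodesN22AtRateRecord12Fixed

/-!
# v1.7 `CoPH` EDITION (HISTORY-INDEXED RESIDUAL 𝐓-WEIGHTS, FINDING №9) of 9″b — the `CoPR ↦ CoPH` image of this seat's v1.6 module `BalabanUVNodesN22AtRateRecord13CoPRFixed` (p533639), itself the
# `CoP ↦ CoPR` image of the v1.5 module (FINDING №8); role and decl list = the ‴ header of record below under T₇ ∘ T₆.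
#
# WHY THIS FILE EXISTS (director-ym LINE №183 RULING H1ʰ ∕ №186 (α) ∕ №187 FILING GATES CLEARED, pub-ymgap INBOX l.20100 ∕ l.20321 ∕ l.20335; def-T LOCATED-9
# «HISTORY-BLIND RESIDUAL 𝐓-WEIGHT SLOT»: v1.6's run-indexed slot `Stage13RParams.Zr p` is still NARROWER than print — print's ζ(Ω^c_{k+1}) ([Balaban1988Convergent] p.257
# L31–34, p.267, (3.2)–(3.5), (3.23) p.270) is built from THE TERM's history (Ω, Λ, …); FINDING-№8 class one index further on the same axis).  def-T's FILE 27
# `Node00/Record13CoPH` (p537939) introduced `structure Stage13HParams extends Stage13RParams` with ONE new HISTORY-INDEXED field `Zh`, the guard `Stage13HParams.ZhUnity`,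
# the proviso core `Stage13HParams.Provisos₁₃CoPH` (rows `zhLaws ∕ zhLocal` replacing `zrLaws ∕ zrLocal`), the datum `datumOfRecord₁₃CoPH`, the record class
# `IsRecordOfRecord₁₃CCoPH` and the one-way history-blind door `Stage13HParams.ofHistoryBlind` from v1.6; RR-2 re-keyed the datum key on it (`Node00/Record13DatumKeyCoPH`, p539151:
# `IsDatumOfRecord₁₃CCoPH ∕ CCoPHOn ∕ CCoPHN`, `IsRecordOfRecord₁₃CCoPHOn ∕ CCoPHN`, the guard of record `unityNondeg₁₃H`); plan presses rev 24 (⁷ = T₇(⁶), K3⁷ `SpineGivenEndpointR13SepCoPH`).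
# A theorem binding `θ : Stage13RParams` cannot be applied at a `Stage13HParams` item tuple's datum, so every storey typed `∀ (θ : Stage13RParams F N) (hc :
# θ.Provisos₁₃CoPR F N), …` is re-keyed ONCE MORE; this file is the (T-RATE) pen's image of its own v1.6 module under def-T's KEY-RULE (T₇), token for token:
#   binder `Stage13RParams ↦ Stage13HParams` (readings `lit ∕ ne1`, residual maps `w1 ∕ ℓ₃ ∕ ne2`, regimes `Rg`, selectors `ksel`, tower families are typed over
#   `Stage13HParams`) · `θ.Provisos₁₃CoPR ↦ θ.Provisos₁₃CoPH` · `datumOfRecord₁₃CoPR ↦ datumOfRecord₁₃CoPH` · `(Is|is)(Datum|Record)OfRecord₁₃CCoPR(On|N) ↦ …₁₃CCoPH(On|N)` ·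
#   guard `θ.ZrUnity ↦ θ.ZhUnity`, `Node00.unityNondeg₁₃R ↦ Node00.unityNondeg₁₃H` · THIS seat's stems `…₁₃CoPR… ↦ …₁₃CoPH…` (`RateReading₁₃CoPH`, `rateCarriersOfRecord₁₃CoPH`,
#   `RRec₁₃CoPH(On)`, `rRec₁₃CoPH…`, `readingOfRecord₁₃CoPH`, `…datumKey₁₃CoPH…`, `n22_tupleReadingOfRecordCoPH(On)…`; the unity-regime example face `…_zrUnity_iff ↦ …_zhUnity_iff`)
#   and module names `…13CoPR… ↦ …13CoPH…`.  NO new SITE-RULE: this lineage reads no 𝐓-weight slot; the θ-only ‴ bundle and closers (`u3OfRecord₁₃`, its faces,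
#   `n22At_u3OfRecord₁₃_…`) and RR-2's `RateAssignment₁₃` stay applied at `θ.toStage13Params` exactly as in v1.6 (the parent view resolves through the two `extends`
#   levels; `θ.toStage12Params ∕ θ.γ ∕ θ.L`, `θ.Admissible F N`, `θ.SlotsNondegenerate₁₃ F N` likewise — unchanged text).
# Statements = the v1.6 statements under the map, proofs = the v1.6 proofs verbatim (kernel re-derivations BY NAME); the ‴ ∕ ⁗ ∕ Co ∕ CoP ∕ CoPR editions of this module
# stay in the tree as the aside items' context (nothing landed is edited or re-declared).  bg-BLIND and 𝐓-WEIGHT-BLIND as before — which is why the port is a token map.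
#
# ITEM IDS: crux names ∕ item ids quoted in the ‴ header of record below are those of EARLIER revisions, asides now; this file is filed `--supports stmt-QuantumFields-20509`
# (K3⁶ `SpineGivenEndpointR13SepCoPR`, the K3 item of record AT FILING TIME — KEY-22 STANDS during the rev-24 press, director-ym №190 ∕ dag-lead DEDUP-301 MIS-KEY rule «a file keyed ⁶ stands, never re-filed»; the K3⁷ `SpineGivenEndpointR13SepCoPH` id follows on dag-lead's WORDS-143) as a HELPER — count-neutral, no stub closed, N22 NOT discharged, no inhabitant of any key claimed (K0 OPEN at every edition), nothing of Bałaban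
# asserted; one finite 𝕋⁴ programme at fixed ε — NOT continuum ∕ OS ∕ mass-gap ∕ Clay.
#
# ‴ HEADER OF RECORD FOLLOWS (token-mapped; its decl lists are this file's, the θ-only names above excepted):
#
# BalabanUVNodes ∕ node N22 — «`FadingMemory` BY NAME FROM A MODULUS» AT THE STAGE-13 HOME, and THE W1 OBJECT READ AT THE STAGE-13 RATE-RECORD HOME:
# `N22At (u3OfRecord₁₃ θ.toStage13Params u k)` from NE9 of the level-`k` functional in ANY fading modulus table (monotonicity in the moduli), the fixed-carrier reading
# `U3Objects₁₁.ofFixed`, and node00-def-W1's history functional `W1.functionalOn S p emb` on `W1.histCarriers` with dag-n22-c's ROAD-1 estimate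
# (`YoungLipschitz` + `Bound238` ⟹ NE9, `…N22W1YoungLipschitz`) plugged in — node N22's stub `S_N22 (RRec₁₃CoPH 𝔯)` for every Stage-13 reading whose level bundles are the W1
# object's, modulo the displayed (2.38)-type hypotheses on W1's cluster tower

Track A of `YM-PLAN.md` (cell `pub-ymgap`, HUMAN RULING D-0062), R134 seat `pub-ymgap-dag-n22-e` (s2 «`FadingMemory` by name from a modulus + knit at the record»), gen 5,
module 9″b = the Stage-13 twin (`12 ↦ 13`) of the lineage's module 3 `…N22AtRateRecord12Fixed.lean` (p466571) at the record OF RECORD (director-ym LINE №125 ∕ №133; route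
rev 16 ∕ 17, K3‴ `SpineGivenEndpointR13` = stmt-QuantumFields-19912; dag-lead WORDS-133 ∕ 134 ∕ 135).  THEOREMS ONLY, every proof one application by name; imports layer B at ₁₃
(`…RateCarriersOfRecord13`) and module 3 (for the stage-free `ne9_of_moduli_le` and n22-c's `…N22W1YoungLipschitz` ∕ W1's `HistoryTermsOfRecord` it brings — reused, not
re-declared); restate-immune (no Theses import); COUNT-NEUTRAL; `--supports` K3‴ (stmt-QuantumFields-19912) as a helper.

WHAT IS KERNEL-CHECKED ([folklore]; 0 `def`, 0 `sorry`; the Stage-12 list under `12 ↦ 13`).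
* §1 `n22At_u3OfRecord₁₃_of_ne9_le` · `n22At_u3OfRecord₁₃_of_ne9_fading` (**`FadingMemory` BY NAME from a modulus** at the Stage-13 bundle, any `u : U3Objects₁₁`) · fixed-carrier
  faces `n22At_u3OfRecord₁₃_ofFixed_iff` ∕ `_ofFixed_of_ne9_fading`.
* §2 `s_N22_rRec₁₃CoPH_of_ne9_fading` (θ-form at the record).
* §3 THE W1 OBJECT at the bundle, ROAD 1: `n22At_u3OfRecord₁₃_w1_of_youngLipschitz` · `n22At_u3OfRecord₁₃_w1Functional_of_youngLipschitz` · `n22At_u3OfRecord₁₃_of_w1Level`.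
* §4 THE W1 OBJECT at the record: `s_N22_rRec₁₃CoPH_of_w1`.

HONEST FRAMING.  Hypothesis-schema bookkeeping: `YoungLipschitz`, `Bound238`, the fading table, the space tables and the numerals are DISPLAYED hypotheses with NO producer in
the tree; W1's cluster tower `S` is residual DATA; nothing of Bałaban's is asserted or instantiated — NE9 is NOT PRINTED for d = 4 and NOT PROVED, (2.40)–(2.41) NOT PROVED;
no inhabitant of `IsDatumOfRecord₁₃CCoPH` claimed (K0‴ `Record13Inhabited`, stmt-QuantumFields-19909, OPEN); N22 NOT discharged; counts UNMOVED (typed 28∕28 · discharged 5∕27,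
A 5∕28); one finite four-torus programme at fixed `ε` — NOT ℝ⁴, NOT infinite volume, NOT OS, NOT a mass gap, NOT Clay.  No decl below carries a cite tag.
-/

noncomputable section

namespace YMDAG.N22

open Set Metric
open scoped BigOperators
open Literature.MathematicalPhysics.QuantumFieldTheory.Balaban1983to89
open Literature.MathematicalPhysics.QuantumFieldTheory.Balaban1983to89.T4Continuum
open Literature.MathematicalPhysics.QuantumFieldTheory.Balaban1983to89.T4OutputRate
open Literature.MathematicalPhysics.QuantumFieldTheory.Balaban1983to89.B12TreeDecay (K₀)
open Literature.MathematicalPhysics.QuantumFieldTheory.Balaban1983to89.Node00 (Stage13HParams IsDatumOfRecord₁₃CCoPH U3Objects₁₁ U3Letters₁₁)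
open Literature.MathematicalPhysics.QuantumFieldTheory.Balaban1983to89.Node00.Sect2 (domSys CPair ofBackgroundC)
open Literature.MathematicalPhysics.QuantumFieldTheory.Balaban1983to89.Node00.W1 (RunPairing histCarriers ClusterTower functionalOn functional box)
open YMDAG.UVSplit

variable {N : ℕ} [NeZero N]

/-! ## §2 … and at the record: `S_N22 (RRec₁₃CoPH 𝔯)` from NE9 of every level functional in a fading table (θ-form) -/

section Record

variable (𝔯 : RateReading₁₃CoPH N)

/-- **`S_N22 (RRec₁₃CoPH 𝔯)` FROM NE9 IN A FADING TABLE, θ-FORM** («`FadingMemory` by name from a modulus» at the record): if at every admissible Stage-13 tuple with provisos,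
every `(g₀, os)` and run length `k`, the reading's U3 objects carry their signs and the level functional `(𝔯.lit F θ hP g₀ os).u3.EA k` has NE9 on `]0, θ.γ]` with the block's
decay in SOME table fading at the block's rate `ω` with amplitude `≤` the block's `C₉`, then node N22's stub holds at the Stage-13 home. [folklore] -/
theorem s_N22_rRec₁₃CoPH_of_ne9_fading
    (h9 : ∀ (F : T4Family) (θ : Stage13HParams F N) (hP : θ.Provisos₁₃CoPH F N), θ.Admissible F N → ∀ (g₀ : ℕ → ℝ) (os : List (ULoop F)) (k : ℕ),
      (𝔯.lit F θ hP g₀ os).u3.Signs ∧ ∃ (Λ : ℕ → ℕ → ℝ) (C₉ : ℝ),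
        NE9 ((𝔯.lit F θ hP g₀ os).u3.EA k) (Window θ.γ) (𝔯.lit F θ hP g₀ os).u3.κ Λ ∧ FadingMemory C₉ (𝔯.lit F θ hP g₀ os).u3.ω Λ ∧
          C₉ ≤ (𝔯.lit F θ hP g₀ os).u3.C₉) :
    S_N22 (RRec₁₃CoPH 𝔯) := by
  rw [s_N22_rRec₁₃CoPH_iff]
  intro F D h g₀ os k
  obtain ⟨hs, Λ, C₉, hne9, hfade, hC₉⟩ := h9 F h.params h.provisos h.admissible g₀ os k
  exact n22At_u3OfRecord₁₃_of_ne9_fading h.params.toStage13Params _ k hs hne9 hfade hC₉ rfl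

end Record

/-! ## §4 THE W1 OBJECT at the record: `S_N22 (RRec₁₃CoPH 𝔯)` for a reading whose bundles are the W1 object's, ROAD 1 -/

section W1Record

variable (𝔯 : RateReading₁₃CoPH N) {𝔸 : Type*}

open Classical in
/-- **`S_N22 (RRec₁₃CoPH 𝔯)` FOR A STAGE-13 READING WHOSE LEVEL BUNDLES ARE THE W1 OBJECT's, ROAD 1.**  If at every admissible Stage-13 tuple with provisos, every `(g₀, os)` AND
EVERY RUN LENGTH `k`, the reading's level-`k` bundle IS the level-`k` bundle of `ofFixed (W1.histCarriers (F.P K) M p) (W1.functionalOn S p emb) EB ℓ` for SOME W1 data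
(torus `K` — node00-def-W1 g2 takes the `k`-th one —, cube side `M`, cluster tower `S`, pairing `p`, reading map `emb`, family `EB`, letter block `ℓ`; `rfl` for W1's reading)
carrying §3's displayed hypotheses (space tables, `Bound238`, `YoungLipschitz` with a fading table on the boxes of `θ.γ`, n22-c's numerals, the letter signs and
inequalities), then node N22's stub holds at the Stage-13 home — where node00-def-W1's NAMED reading and n22-c's estimate MEET. [folklore] -/
theorem s_N22_rRec₁₃CoPH_of_w1
    (hw1 : ∀ (F : T4Family) (θ : Stage13HParams F N) (hP : θ.Provisos₁₃CoPH F N), θ.Admissible F N → ∀ (g₀ : ℕ → ℝ) (os : List (ULoop F)) (k : ℕ),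
      ∃ (K M : ℕ) (S : ClusterTower (F.P K) 𝔸 M) (p : RunPairing) (emb : p.BgA → CPair (F.P K) 𝔸)
        (EB : ℝ → Functional (histCarriers (F.P K) M p) (histCarriers (F.P K) M p).BgB) (ℓ : U3Letters₁₁)
        (sp : (j : ℕ) → (domSys (F.P K) M (j + 1)).Dom → Set (CPair (F.P K) 𝔸)) (A R r₁ C₉ ω : ℝ) (ℓtab : ℕ → ℕ → ℝ),
        u3OfRecord₁₃ θ.toStage13Params (𝔯.lit F θ hP g₀ os).u3 k = u3OfRecord₁₃ θ.toStage13Params (U3Objects₁₁.ofFixed (histCarriers (F.P K) M p) (functionalOn S p emb) EB ℓ) k ∧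
        (∀ (j : ℕ) (U : p.BgA) Z, emb U ∈ sp j Z) ∧ 0 < A ∧ 0 ≤ r₁ ∧ ℓ.κ ≤ r₁ ∧ r₁ + 2 * (64 * Real.log 162) + 2 ≤ R ∧
        2 * A * Real.exp (5 * r₁ + 1) * K₀ 64 8 * 9 * 64 ≤ 1 ∧ FadingMemory C₉ ω ℓtab ∧
        (∀ j, (S j).Bound238 (box θ.γ j) (sp j) A R) ∧ (∀ j, (S j).YoungLipschitz (box θ.γ j) (sp j) (fun i : Fin (j + 1) => ℓtab (j + 1) i) R) ∧
        ℓ.Signs ∧ ω = ℓ.ω ∧ 8 * (Real.exp 1 * 9 * 64 * K₀ 64 8 ^ 2) * C₉ ≤ ℓ.C₉) :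
    S_N22 (RRec₁₃CoPH 𝔯) := by
  rw [s_N22_rRec₁₃CoPH_iff]
  intro F D h g₀ os k
  obtain ⟨K, M, S, p, emb, EB, ℓ, sp, A, R, r₁, C₉, ω, ℓtab, hu, hsp, hA, hr₁, hκ, hrate, hsmall, hfade, h238, hYL, hs, hω, hC₉⟩ :=
    hw1 F h.params h.provisos h.admissible g₀ os k
  exact n22At_u3OfRecord₁₃_of_w1Level F h.params.toStage13Params K _ k S p emb EB ℓ hu sp hsp ℓtab hA hr₁ hκ hrate hsmall hfade h238 hYL hs hω hC₉

end W1Record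

end YMDAG.N22

end
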